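import Summits.FinalStateConjecture.FinalStateConjecture.Theses.BartnikGapSettling
import Literature.Geometry.Lorentzian.BondiBartnikGap
import Literature.Geometry.Lorentzian.NearKerrCollarCore
import Literature.Geometry.Lorentzian.HawkingMassFlux
import Literature.Geometry.Lorentzian.KerrPhotonOrbit

/-!
# Crux `GapExhaustion` (stmt-FinalStateConjecture-10808) — ideator 1, round 1: first lemmas

Scratch file of `planner-cruxidea-stmt-FinalStateConjecture-10808-1-0`. Two crux idea cards:

* §A  `omega-limit-gap-readout` — the gap along converging late collars tends to the DARK
  REMAINDER `M_B(∞) − M_f`; typed: the calibration `KerrCollarMinimalityQuant` (route-review O1's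
  KCM, quantitative form), the new far-zone lever `FarConeTightness`, and the readout algebra
  `gap_readout` (proved).
* §B  `photon-shell-pseudoconvexity` — Ionescu–Klainerman Killing extension sweeps the scri-side
  silence of an eternal limit inward exactly down to the retrograde photon radius; typed: the
  pseudo-convexity of the Kerr radius beyond `r_ph⁻(M,a)` in turning-point form
  (`kerr_radius_pseudoconvex_outside_photon_shell`, checked numerically in
  `compute/pseudoconvex_kerr.py`).

Nothing here is a skeleton; `sorry` only in the two open first lemmas.
-/

noncomputable section

namespace Summit.FinalStateConjecture.FinalStateConjecture.Cruxes.GapExhaustion.Ideator1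

open Literature.Geometry.Lorentzian
open Set Filter Topology
open scoped Manifold ContDiff Topology ENNReal

/-! ## §A. Card `omega-limit-gap-readout` -/

/-- **(K) Quantitative Kerr-collar minimality** (route-review objection O1's `KCM`, typed; the
calibration stub shared with `BondiBartnikRigidity`): for every margin `χ < 1`, mass window `m₀`
and `ε > 0` there are `k, δ > 0` such that in every MGHD of admissible data, every competitor mass
(`VacuumCauchyDevelopment.IsCompetitorMass`, a cut Bondi ENERGY, hence `≥` the competitor's rest
mass) of the thick collar `Φ({t* = 0, M < r ≤ 3M})` of a Kerr-star chart `δ`-close in `Cᵏ` to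
`Kerr(M,a)`, `m₀ ≤ M ≤ 1/m₀`, `|a| ≤ χM`, is at least `M − ε`. A Bondi/null Penrose-type inequality
with angular momentum and Kerr rigidity of its equality case; open even at `a = 0`
(arXiv:1506.06400 covers only perturbations of Schwarzschild cones). -/
def KerrCollarMinimalityQuant : Prop :=
  ∀ (χ m₀ ε : ℝ), χ < 1 → 0 < m₀ → 0 < ε → ∃ (k : ℕ) (δ : ℝ≥0∞), 0 < δ ∧
    ∀ (X : Type) [TopologicalSpace X] [ChartedSpace E3 X] [IsManifold (𝓡 3) ∞ X] [T2Space X]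
      [SecondCountableTopology X] [ConnectedSpace X], ∀ D ∈ admissibleVacuumData X,
      ∀ (𝒟 : VacuumCauchyDevelopment D) (M a : ℝ) (mo : lorentzGroup × E4) (B : ModelBackground)
        (Φ : B.domain → 𝒟.carrier), 𝒟.IsMaximal → m₀ ≤ M → M ≤ m₀⁻¹ → |a| ≤ χ * M →
        B = starBackground mo.1 mo.2 M a (fun x => Kerr.radius a (poincareInv mo.1 mo.2 x)) →
        ContMDiffOn 𝓘(ℝ, E4) (𝓡 4) ∞ Φ
          {x | -1 < B.time x.1 ∧ B.time x.1 < 1 ∧ B.radius x.1 < 3 * M + 1} →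
        Topology.IsOpenEmbedding
          ({x | -1 < B.time x.1 ∧ B.time x.1 < 1 ∧ B.radius x.1 < 3 * M + 1}.restrict Φ) →
        𝒟.toSpacetime.truncDeviationCk B Φ k (3 * M) 0 ≤ δ →
        ∀ m' : ℝ, 𝒟.IsCompetitorMass (Φ '' B.truncTimeSlab (3 * M) 0) m' → M - ε ≤ m'

/-- **(F) Far-cone tightness / no dark remainder** — the new far-zone lever of card A, typed for
the sector `N ≤ 1` in which the filed crux survives (single, connected collar core with the probe
point inside the collar; for `N = 0` the core is the probe point). Beyond some late compact set and
some area radius `R`, a doubly convex foliation of the cut cone `∂J⁺(core)` carrying the Hawking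
flux identity and having Hawking masses converging to `m` gains at most `ε` of Hawking mass beyond
radius `R`: no Bondi energy crosses the far part of late collar cones (late incoming radiation is
backscatter, and far-zone field energy of a single hole is Coulombic, already counted at radius
`R`). It fails for two-hole developments (the second hole crosses the far cone) — the `N ≥ 2`
sector is exactly where the filed crux is refuted on paper (rattack D1/D2). -/
def FarConeTightness : Prop :=
  ∀ (X : Type) [TopologicalSpace X] [ChartedSpace E3 X] [IsManifold (𝓡 3) ∞ X] [T2Space X]
    [SecondCountableTopology X] [ConnectedSpace X], ∀ D ∈ admissibleVacuumData X,
    ∀ 𝒟 : VacuumCauchyDevelopment D, 𝒟.IsMaximal →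
      Summit.FinalStateConjecture.HasCompleteNullInfinity 𝒟.toCauchyDevelopment →
      ∀ (k : ℕ) (Λ : ℝ≥0∞) (ε : ℝ), Λ < ⊤ → 0 < ε →
        ∃ (R : ℝ) (K : Set 𝒟.carrier), IsCompact K ∧
          ∀ (N : ℕ) (M a : Fin N → ℝ) (S : Set 𝒟.carrier) (p : 𝒟.carrier)
            (mo : Fin N → lorentzGroup × E4) (B : Fin N → ModelBackground)
            (Φ : ∀ i, (B i).domain → 𝒟.carrier),
            N ≤ 1 → 𝒟.toCauchyDevelopment.IsNearKerrLeaf k Λ N M a S → p ∈ S →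
            Disjoint (𝒟.metric.causalFuture 𝒟.timeOrientation S)
              (𝒟.metric.causalPast 𝒟.timeOrientation K) →
            (∀ i, B i = starBackground (mo i).1 (mo i).2 (M i) (a i)
              (fun x => Kerr.radius (a i) (poincareInv (mo i).1 (mo i).2 x))) →
            (∀ i, ContMDiffOn 𝓘(ℝ, E4) (𝓡 4) ∞ (Φ i)
                {x | -1 < (B i).time x.1 ∧ (B i).time x.1 < 1 ∧ (B i).radius x.1 < 3 * M i + 1} ∧
              Topology.IsOpenEmbedding
                ({x | -1 < (B i).time x.1 ∧ (B i).time x.1 < 1 ∧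
                    (B i).radius x.1 < 3 * M i + 1}.restrict (Φ i))) →
            (∀ i, Φ i '' (B i).truncTimeSlab (3 * M i) 0 ⊆ S) →
            (∀ i, p ∈ Φ i '' (B i).truncTimeSlab (3 * M i) 0) →
            ∀ (𝒩 : 𝒟.metric.NullHypersurface 𝒟.timeOrientation) (m : ℝ),
              (∀ s, range (𝒩.sec s) ⊆
                frontier (𝒟.metric.causalFuture 𝒟.timeOrientation (collarCore M p B Φ))) →
              𝒩.IsDoublyConvex → 𝒩.HasHawkingFlux →
              Tendsto 𝒩.hawkingMass atTop (𝓝 m) →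
              ∀ s, R ≤ 𝒩.areaRadius s → m - 𝒩.hawkingMass s ≤ ε

/-- **Readout algebra** (card A's glue, proved): along a sequence of late collar cores, if the own
cut rest masses `mB n → M∞` (Bondi mass limit), the collar Kerr masses `Mcol n → Mf`, the
calibration (K) gives `β n ≥ Mcol n − w n` with `w n → 0`, and there is no dark remainder
`M∞ = Mf`, then the gaps `mB n − β n` are eventually `≤ γ` for every `γ > 0` — which, for the
`∃`-form of `GapExhaustion`, is all the gap clause asks. [folklore] -/
theorem gap_readout {mB β Mcol w : ℕ → ℝ} {Minf Mf : ℝ}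
    (hB : Tendsto mB atTop (𝓝 Minf)) (hcol : Tendsto Mcol atTop (𝓝 Mf))
    (hK : ∀ n, Mcol n - w n ≤ β n) (hw : Tendsto w atTop (𝓝 0)) (hdark : Minf = Mf) :
    ∀ γ > 0, ∀ᶠ n in atTop, mB n - β n ≤ γ := by
  intro γ hγ
  have h : Tendsto (fun n ↦ mB n - (Mcol n - w n)) atTop (𝓝 (Minf - (Mf - 0))) :=
    hB.sub (hcol.sub hw)
  have h' : Minf - (Mf - 0) < γ := by rw [hdark]; linarith
  filter_upwards [h.eventually (gt_mem_nhds h')] with n hn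
  linarith [hK n]

/-! ## §B. Card `photon-shell-pseudoconvexity` -/

/-- **First lemma of card B: the Kerr radius is strongly pseudo-convex outside the photon shell**
(turning-point form of Ionescu–Klainerman arXiv:1108.3575 Def. 1.1 for the domains `{r > c}`): in
sub-extremal Kerr, if a null geodesic is tangent to the level set `{r = c}` at parameter `s₀`
(`(r ∘ γ)'(s₀) = 0`) and `c` exceeds the retrograde equatorial photon radius `r_ph⁻(M,a)` (the
unique root `r₀ ≥ 3M` of `r(r − 3M)² = 4a²M`, Bardeen–Press–Teukolsky 1972 (2.18),
`Kerr.exists_photonRadius`), then `(r ∘ γ)''(s₀) > 0` — the geodesic bends back OUT into `{r > c}`,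
i.e. every tangency is a pericentre. Equivalently `D²(c − r)(X,X) < 0` for null `X` tangent to
`{r = c}`, so Thm 1.2 of arXiv:1108.3575 extends Killing fields from `{r > c}` across `{r = c}`
for every `c > r_ph⁻`; it fails at `c = r_ph⁻` (the orbit itself). Carter potential check:
`R(c) = 0 ∧ Θ-admissible ⇒ R'(c) > 0` for `c > r_ph⁻(a)`, verified on a grid for
`a/M ∈ {0, .3, .5, .7, .9, .99, .999}` (compute/pseudoconvex_kerr.py, this folder). -/
theorem kerr_radius_pseudoconvex_outside_photon_shell [Kerr.Facts] [Kerr.SliceFacts] {M a : ℝ}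
    (hM : 0 < M) (ha : |a| < M) :
    ∀ (γ : ℝ → Kerr.exterior M a) (s₀ r₀ : ℝ),
      IsGeodesic (Kerr.smoothMetric M a (Kerr.rPlus M a)).leviCivita γ →
      (Kerr.smoothMetric M a (Kerr.rPlus M a)).IsNull (velocity 𝓘(ℝ, E4) γ s₀) →
      velocity 𝓘(ℝ, E4) γ s₀ ≠ 0 →
      3 * M ≤ r₀ → r₀ * (r₀ - 3 * M) ^ 2 = 4 * a ^ 2 * M →
      r₀ < Kerr.radius a (γ s₀ : E4) →
      deriv (fun s ↦ Kerr.radius a (γ s : E4)) s₀ = 0 →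
      0 < deriv (deriv fun s ↦ Kerr.radius a (γ s : E4)) s₀ := by
  sorry

/-- **Companion (inner side, informal caveat typed as a hypothesis on the energy)**: inside the
prograde photon radius every tangency of a null geodesic of non-negative Killing energy
`E = −g(γ', ∂_{t*}) ≥ 0`... is an apocentre. Recorded only as the statement card B's horizon-side
sweep would need; the ergoregion part (`E ≤ 0` geodesics) is deliberately excluded by the
hypothesis `hE`, and the lemma is NOT the card's first lemma. -/
theorem kerr_radius_pseudoconcave_inside_photon_shell [Kerr.Facts] [Kerr.SliceFacts] {M a : ℝ}
    (hM : 0 < M) (ha : |a| < M) :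
    ∀ (γ : ℝ → Kerr.exterior M a) (s₀ r₁ : ℝ),
      IsGeodesic (Kerr.smoothMetric M a (Kerr.rPlus M a)).leviCivita γ →
      (Kerr.smoothMetric M a (Kerr.rPlus M a)).IsNull (velocity 𝓘(ℝ, E4) γ s₀) →
      velocity 𝓘(ℝ, E4) γ s₀ ≠ 0 →
      0 < E4.time (velocity 𝓘(ℝ, E4) γ s₀) →            -- future-directed in `t*`
      (hE : 0 ≤ -(Kerr.bilin M a (γ s₀ : E4) (velocity 𝓘(ℝ, E4) γ s₀) (E4.basisVector 0))) →
      M ≤ r₁ → r₁ < 3 * M → r₁ * (r₁ - 3 * M) ^ 2 = 4 * a ^ 2 * M →   -- r₁ = prograde radius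
      Kerr.radius a (γ s₀ : E4) < r₁ →
      deriv (fun s ↦ Kerr.radius a (γ s : E4)) s₀ = 0 →
      deriv (deriv fun s ↦ Kerr.radius a (γ s : E4)) s₀ < 0 := by
  sorry

end Summit.FinalStateConjecture.FinalStateConjecture.Cruxes.GapExhaustion.Ideator1
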